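/-
Copyright (c) 2026 the pub-hodgecm-mathlib formalisation cell (harness21).  Prover seat hodgecm-mathlib-K2E2-p12 (g3): Track B «K2-LIT»,
#184♮ = hLiu418 = stmt-HodgeConjecture-24832; organ #33b (c2) «THE RESTRICTED PRODUCT OF LOCAL SIEGEL SECTIONS IS CONTINUOUS» of the tier-1 socket
module `Cruxes/HLiu418/Lines/K2_Liu_CurveThetaSigs_U5d_ZetaS.lean` (continuity clause of #33b `hBC`; LEAD F0P6-plan (g11) GO (c2) 2026-09-04T05:07:31Z); 2026-09-04.
-/
import Summits.HodgeConjecture.HodgeConjecture.Theorems.K2LiuSiegelSectionRestrictedProduct   -- ★ (c1): `finprod_lambdaLoc_mul_of_mem_localInt`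
import HarnessLib

/-!
# Crux `HLiu418`, Track B road `K2_Liu`, unit U5d «`Z_S`», organ #33b (c2):
# the restricted product `φ(h) = fS(h_∞, h_S) · ∏ᶠ_{v∉S} Λ_{s₀,v}(h_v)` is continuous on `H(𝔸)`

Cell `hodgecm-mathlib`, crux item hLiu418 = `stmt-HodgeConjecture-24832`, route of record `HCCMUnconditional`; squad K2 ∕ K2Liu.

Restricted-product local finiteness, in the form the tree already holds: the integral level `K⁰ = {k | k_v ∈ K_{H,v} ∀ v}` is OPEN in `H(𝔸)`
(★ `isOpen_finAdelicIntegralLevel`, pulled back along ★ `continuous_finPart`), and `h ↦ ∏ᶠ_{v∉S} Λ_{s₀,v}(h_v)` is constant on every coset `h₀ K⁰`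
(★ (c1) `finprod_lambdaLoc_mul_of_mem_localInt`, i.e. ★ `lambdaLoc_mul_localInt` place by place) — so it is LOCALLY CONSTANT, and `φ` is continuous as soon
as `fS` is (`continuous_restrictedProduct`). [cite: Tan1999, §1] [cite: BorelJacquet1979, §4.1] [cite: PlatonovRapinchuk1994, §5.1]

HONEST LABEL: HC_CM is proved only modulo the 7 printed citations (2 remaining named inputs: hLiu418 = stmt-HodgeConjecture-24832,
h413 = stmt-HodgeConjecture-24833) until rung 0 closes; this file is a helper (`--supports stmt-HodgeConjecture-24832`) and closes no socket by itself.
-/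

set_option linter.dupNamespace false

noncomputable section

open scoped RestrictedProduct Topology
open Filter NumberField IsDedekindDomain

namespace Summit.HodgeConjecture.HodgeConjecture.Cruxes.HLiu418.K2LiuSiegelSectionRestrictedProductContinuous

open Literature.NumberTheory.K2Lit.PlaceSplitting
open Literature.NumberTheory.Automorphic Literature.NumberTheory.Automorphic.UnitaryGroup Literature.NumberTheory.GaloisRepresentations
open Literature.NumberTheory.GelbartRogawski1991 Literature.NumberTheory.GelbartRogawski1991.GRConstruction
open Literature.NumberTheory.K2Lit.SiegelDoubled
open Summit.HodgeConjecture.HodgeConjecture.Cruxes.HLiu418.K2LiuStdFamilyFactorisable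
open Summit.HodgeConjecture.HodgeConjecture.Cruxes.HLiu418.K2LiuSiegelSectionRestrictedProduct

variable (L : Type) [Field L] [NumberField L] [IsCMField L]
variable {N M n : ℕ} (e : Fin N × Fin M ≃ Fin n)
  (dV : Fin N → L) (hdV : ∀ i, IsCMField.complexConj L (dV i) = dV i)
  (dW : Fin M → L) (hdW : ∀ i, IsCMField.complexConj L (dW i) = dW i)
  (S : Finset (HeightOneSpectrum (𝓞 (Fp L)))) [DecidableEq (HeightOneSpectrum (𝓞 (Fp L)))]
  (χ : HeckeCharacter L) (s₀ : ℂ)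

omit [DecidableEq (HeightOneSpectrum (𝓞 (Fp L)))] in
/-- **the integral level `K⁰ = {k ∈ H(𝔸) | k_v ∈ K_{H,v} for every finite `v`}` is open** (★ `isOpen_finAdelicIntegralLevel` ∕ ★ `mem_finAdelicIntegralLevel_iff_forall`
pulled back along ★ `continuous_finPart`). [cite: PlatonovRapinchuk1994, §5.1] [cite: BorelJacquet1979, §4.1] -/
theorem isOpen_setOf_forall_evalPlace_finPart_mem_localInt : IsOpen {k : HA L e dV hdV dW hdW | ∀ v, evalPlace (Fp L) L (IsCMField.complexConj L) (n + n) (hermD L e dV hdV dW hdW) v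
    (finPart (Fp L) L (IsCMField.complexConj L) (n + n) (hermD L e dV hdV dW hdW) k) ∈ localInt L (IsCMField.complexConj L) (n + n) (hermD L e dV hdV dW hdW) v} := by
  have h : {k : HA L e dV hdV dW hdW | ∀ v, evalPlace (Fp L) L (IsCMField.complexConj L) (n + n) (hermD L e dV hdV dW hdW) v (finPart (Fp L) L (IsCMField.complexConj L) (n + n)
      (hermD L e dV hdV dW hdW) k) ∈ localInt L (IsCMField.complexConj L) (n + n) (hermD L e dV hdV dW hdW) v} =
      (fun k : HA L e dV hdV dW hdW => finPart (Fp L) L (IsCMField.complexConj L) (n + n) (hermD L e dV hdV dW hdW) k) ⁻¹' (finAdelicIntegralLevel (Fp L) L (IsCMField.complexConj L)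
          (n + n) (hermD L e dV hdV dW hdW) : Set (finAdelic (Fp L) L (IsCMField.complexConj L) (n + n) (hermD L e dV hdV dW hdW))) :=
    Set.ext fun k => (mem_finAdelicIntegralLevel_iff_forall (Fp L) L (IsCMField.complexConj L) (n + n) (hermD L e dV hdV dW hdW) (finPart (Fp L) L (IsCMField.complexConj L) (n + n)
        (hermD L e dV hdV dW hdW) k)).symm
  rw [h]
  exact (isOpen_finAdelicIntegralLevel (Fp L) L (IsCMField.complexConj L) (n + n) (hermD L e dV hdV dW hdW)).preimage (continuous_finPart (Fp L) L (IsCMField.complexConj L) (n + n)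
      (hermD L e dV hdV dW hdW))

omit [DecidableEq (HeightOneSpectrum (𝓞 (Fp L)))] in
/-- **`h ↦ ∏ᶠ_{v∉S} Λ_{s₀,v}(h_v)` is locally constant on `H(𝔸)`**: it is constant on every coset `h₀ K⁰` of the open integral level
(★ (c1) `finprod_lambdaLoc_mul_of_mem_localInt`). [cite: Tan1999, §1] [cite: BorelJacquet1979, §4.1] -/
theorem isLocallyConstant_finprod_lambdaLoc (hχ : ∀ v, v ∉ S → ∀ w' : PlacesOver L v, χ.IsUnramifiedAt w'.1) :
    IsLocallyConstant (fun h : HA L e dV hdV dW hdW => ∏ᶠ v : {v : HeightOneSpectrum (𝓞 (Fp L)) // v ∉ S}, LambdaLoc L e dV hdV dW hdW v.1 χ s₀ (evalPlace (Fp L) L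
        (IsCMField.complexConj L) (n + n) (hermD L e dV hdV dW hdW) v.1 (finPart (Fp L) L (IsCMField.complexConj L) (n + n) (hermD L e dV hdV dW hdW) h))) := by
  refine (IsLocallyConstant.iff_eventually_eq _).2 fun h₀ => ?_
  have hO := isOpen_setOf_forall_evalPlace_finPart_mem_localInt L e dV hdV dW hdW
  have h1 : (Homeomorph.mulLeft h₀) '' {k : HA L e dV hdV dW hdW | ∀ v, evalPlace (Fp L) L (IsCMField.complexConj L) (n + n) (hermD L e dV hdV dW hdW) v (finPart (Fp L) L
      (IsCMField.complexConj L) (n + n) (hermD L e dV hdV dW hdW) k) ∈ localInt L (IsCMField.complexConj L) (n + n) (hermD L e dV hdV dW hdW) v} ∈ 𝓝 h₀ :=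
    ((Homeomorph.mulLeft h₀).isOpenMap _ hO).mem_nhds ⟨1, fun v => by rw [finPart_one', map_one]; exact one_mem _, mul_one h₀⟩
  filter_upwards [h1]
  rintro _ ⟨k, hk, rfl⟩
  exact finprod_lambdaLoc_mul_of_mem_localInt L e dV hdV dW hdW S χ s₀ hχ h₀ k hk

omit [DecidableEq (HeightOneSpectrum (𝓞 (Fp L)))] in
/-- the read-out `h ↦ (h_∞, (h_v)_{v∈S})` is continuous (★ `continuous_archPart`, ★ `continuous_evalPlace`, ★ `continuous_finPart`). [cite: BorelJacquet1979, §4.1] -/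
theorem continuous_cmp : Continuous fun h : HA L e dV hdV dW hdW => (archPart (Fp L) L (IsCMField.complexConj L) (n + n) (hermD L e dV hdV dW hdW) h, fun v : S => evalPlace (Fp L) L
    (IsCMField.complexConj L) (n + n) (hermD L e dV hdV dW hdW) v.1 (finPart (Fp L) L (IsCMField.complexConj L) (n + n) (hermD L e dV hdV dW hdW) h)) :=
  (continuous_archPart (Fp L) L (IsCMField.complexConj L) (n + n) (hermD L e dV hdV dW hdW) : Continuous fun h : HA L e dV hdV dW hdW => archPart (Fp L) L (IsCMField.complexConj L)
      (n + n) (hermD L e dV hdV dW hdW) h).prodMk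
    (continuous_pi fun v : S => (continuous_evalPlace (Fp L) L (IsCMField.complexConj L) (n + n) (hermD L e dV hdV dW hdW) v.1).comp (continuous_finPart (Fp L) L (IsCMField.complexConj L)
        (n + n) (hermD L e dV hdV dW hdW) : Continuous fun h : HA L e dV hdV dW hdW => finPart (Fp L) L (IsCMField.complexConj L) (n + n) (hermD L e dV hdV dW hdW) h))

omit [DecidableEq (HeightOneSpectrum (𝓞 (Fp L)))] in
/-- **THE RESTRICTED PRODUCT OF LOCAL SIEGEL SECTIONS IS CONTINUOUS** (#33b (c2)): for continuous `fS` on `H_∞ × ∏_{v∈S} H(L⁺_v)` and `χ` unramified off `S`,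
`φ(h) = fS(h_∞, h_S) · ∏ᶠ_{v∉S} Λ_{s₀,v}(h_v)` is continuous on `H(𝔸)` (continuous read-out × locally constant factor).
[cite: Tan1999, §1] [cite: BorelJacquet1979, §4.1] [cite: Liu2011, §2B p. 862] -/
theorem continuous_restrictedProduct (hχ : ∀ v, v ∉ S → ∀ w' : PlacesOver L v, χ.IsUnramifiedAt w'.1) (fS : arch (Fp L) L (IsCMField.complexConj L) (n + n) (hermD L e dV hdV dW hdW) ×
    (Π v : S, localPi L (IsCMField.complexConj L) (n + n) (hermD L e dV hdV dW hdW) v.1) → ℂ) (hfS : Continuous fS) :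
    Continuous (fun h : HA L e dV hdV dW hdW => fS (archPart (Fp L) L (IsCMField.complexConj L) (n + n) (hermD L e dV hdV dW hdW) h, fun v : S => evalPlace (Fp L) L
        (IsCMField.complexConj L) (n + n) (hermD L e dV hdV dW hdW) v.1 (finPart (Fp L) L (IsCMField.complexConj L) (n + n) (hermD L e dV hdV dW hdW) h)) * ∏ᶠ v : {v : HeightOneSpectrum
        (𝓞 (Fp L)) // v ∉ S}, LambdaLoc L e dV hdV dW hdW v.1 χ s₀ (evalPlace (Fp L) L (IsCMField.complexConj L) (n + n) (hermD L e dV hdV dW hdW) v.1 (finPart (Fp L) L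
        (IsCMField.complexConj L) (n + n) (hermD L e dV hdV dW hdW) h))) :=
  (hfS.comp (continuous_cmp L e dV hdV dW hdW S)).mul (isLocallyConstant_finprod_lambdaLoc L e dV hdV dW hdW S χ s₀ hχ).continuous

end Summit.HodgeConjecture.HodgeConjecture.Cruxes.HLiu418.K2LiuSiegelSectionRestrictedProductContinuous

end
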